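import Literature.IUT.LogVolume.HullModel
import Literature.IUT.LogVolume.PacketVolume
import Literature.IUT.LogThetaLattice.HolomorphicHull
import HarnessLib

/-!
# [IUTchIII] Remark 3.9.5 (iv), the hull case, in the model: nested hull sets with the same
# log-volume coincide, hence `Φ(P) = Ξ(P) = {φ(P)}` for `P ∈ Hul`

Mochizuki, [IUTchIII] Rmk. 3.9.5 (iv), kurims p. 129: "if `P ∈ Hul`, then `{φ(P)} = Φ(P) = Ξ(P)`, so
`P = φ(P) = H_Φ(P) = H_Ξ(P)`". The layer-L6 file `Literature/IUT/LogThetaLattice/HolomorphicHull.lean`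
(abc-iut-L6-t4) types this as the NAMED statement `Remark395iv_hullCase Hul φ μlog` over abstract
`Hul`, `φ`, `μlog`, noting that "it uses that distinct nested hulls have distinct log-volumes".

This file proves that key fact in the CONSTRUCTED model of this directory — finite direct sums
`⊕_j K_j` of nonarchimedean local fields, hull sets `λ·O_L` (`hullSets K`), the constructed hull
`holomorphicHull K`, and the weighted log-volume of [IUTchIII] Rmk. 3.1.1 (iii) with POSITIVE weights,
read on subsets through their coordinate projections (`boxLogVolume`):
* `mulLogVolume_le_of_norm_le`, `norm_eq_of_mulLogVolume_eq` — `λ ↦ μ^log(λ·O_K)` is monotone in `‖λ‖` and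
  injective on norms (via `‖λ‖ = ‖ϖ‖^{ord λ}`, `μ^log(λ·O_K) = −ord(λ)·log q`);
* `hullSet_eq_of_subset_of_boxLogVolume_le` — nested hull sets `H ⊆ H'` with `μ^log(H') ≤ μ^log(H)`
  are EQUAL;
* `lt_remark395iv_hullCase` — the DISCHARGE of L6's `Remark395iv_hullCase (hullSets K) (holomorphicHull K)
  (boxLogVolume K w)` for every positive weight vector `w`.
[cite: Mochizuki2012, IUTchIII Rmk. 3.9.5 (iv) p. 129] [cite: Mochizuki2012, IUTchIII Rmk. 3.1.1 (iii) p. 95]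
Deliberately NOT here: (Ξ1)–(Ξ3) (nonemptiness / strictness examples), any judgement on Cor. 3.12.
-/

noncomputable section

open MeasureTheory Set Metric TopologicalSpace Bornology
open scoped ENNReal NNReal Pointwise NormedField
open Literature.NumberTheory.GaloisRepresentations.Ultrametric

namespace Literature.IUT.LogVolume

variable {J : Type*} [Fintype J] (K : J → Type*) [∀ j, NontriviallyNormedField (K j)]
  [∀ j, IsUltrametricDist (K j)] [∀ j, ProperSpace (K j)] [∀ j, MeasurableSpace (K j)]
  [∀ j, BorelSpace (K j)]

/-! ### Log-volumes of subsets through their coordinate projections -/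

omit [Fintype J] [∀ j, NontriviallyNormedField (K j)] [∀ j, IsUltrametricDist (K j)] [∀ j, ProperSpace (K j)]
  [∀ j, MeasurableSpace (K j)] [∀ j, BorelSpace (K j)] in
/-- The `j`-th coordinate projection of a subset of `⊕_j K_j` (for a box with nonempty factors, its
`j`-th factor). [cite: Mochizuki2012, IUTchIII Rmk. 3.1.1 (iii) p. 95] -/
def boxFactor (S : Set (Π j, K j)) (j : J) : Set (K j) := Function.eval j '' S

omit [Fintype J] [∀ j, NontriviallyNormedField (K j)] [∀ j, IsUltrametricDist (K j)] [∀ j, ProperSpace (K j)]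
  [∀ j, MeasurableSpace (K j)] [∀ j, BorelSpace (K j)] in
/-- The factors of a box with nonempty factors. [cite: Mochizuki2012, IUTchIII Rmk. 3.1.1 (iii) p. 95] -/
theorem boxFactor_pi {A : Π j, Set (K j)} (hA : ∀ j, (A j).Nonempty) (j : J) :
    boxFactor K (Set.pi univ A) j = A j := by
  classical
  unfold boxFactor
  exact Set.eval_image_univ_pi (Set.univ_pi_nonempty_iff.mpr hA)

/-- The weighted log-volume `Σ_j w_j·μ^log_j(pr_j S)` of [IUTchIII] Rmk. 3.1.1 (iii), read on SUBSETS of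
`⊕_j K_j` through their coordinate projections (it is the weighted log-volume of the factors on direct
product regions). [cite: Mochizuki2012, IUTchIII Rmk. 3.1.1 (iii) p. 95] -/
def boxLogVolume (w : J → ℝ) (S : Set (Π j, K j)) : ℝ :=
  IntegralStructure.weightedLogVolume (fun j => unitBallStructure (K j)) w (boxFactor K S)

/-- On a box with nonempty factors `boxLogVolume` is the weighted log-volume of the factors.
[cite: Mochizuki2012, IUTchIII Rmk. 3.1.1 (iii) p. 95] -/
theorem boxLogVolume_pi (w : J → ℝ) {A : Π j, Set (K j)} (hA : ∀ j, (A j).Nonempty) :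
    boxLogVolume K w (Set.pi univ A) =
      IntegralStructure.weightedLogVolume (fun j => unitBallStructure (K j)) w A := by
  unfold boxLogVolume
  congr 1
  funext j
  exact boxFactor_pi K hA j

/-- The log-volume of a hull set: `μ^log(λ·O_L) = Σ_j w_j·μ^log(λ_j·O_{K_j})`.
[cite: Mochizuki2012, IUTchIII Rmk. 3.9.5 (i) p. 127] -/
theorem boxLogVolume_hullSet (w : J → ℝ) (c : Π j, (K j)ˣ) :
    boxLogVolume K w (hullSet K (fun j => (c j : K j))) = ∑ j, w j * mulLogVolume (K j) (c j) := by
  rw [show hullSet K (fun j => (c j : K j)) = Set.pi univ (fun j => closedBall (0 : K j) ‖(c j : K j)‖)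
    from rfl, boxLogVolume_pi K w (fun j => ⟨0, by simp⟩), weightedLogVolume_hullSet]

/-! ### `λ ↦ μ^log(λ·O_K)` is monotone in `‖λ‖` and injective on norms -/

omit [Fintype J] [∀ j, IsUltrametricDist (K j)] [∀ j, ProperSpace (K j)] [∀ j, MeasurableSpace (K j)]
  [∀ j, BorelSpace (K j)] in
/-- `λ·O ⊆ λ'·O ↔ ‖λ‖ ≤ ‖λ'‖` coordinatewise: inclusion of hull sets is comparison of radii.
[cite: Mochizuki2012, IUTchIII Rmk. 3.9.5 (i) p. 127] -/
theorem hullSet_subset_iff {c d : Π j, K j} : hullSet K c ⊆ hullSet K d ↔ ∀ j, ‖c j‖ ≤ ‖d j‖ := by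
  constructor
  · intro h j
    have hc : c ∈ hullSet K c := (mem_polydisc K).mpr fun j => le_rfl
    exact (mem_polydisc K).mp (h hc) j
  · intro h
    exact polydisc_mono K h

omit [Fintype J] in
/-- `μ^log(λ·O_K) = −ord(λ)·log q_K` with `‖λ‖ = ‖ϖ‖^{ord λ}`. [cite: MochizukiAbsTopIII2015, Prop. 5.7 (i)(b) p. 137] -/
theorem mulLogVolume_eq_neg_ordFun (j : J) {ϖ : (K j)ˣ} (hϖ : IsUniformizer ϖ) (x : (K j)ˣ) :
    mulLogVolume (K j) x = -(hϖ.ordFun x * Real.log (residueCard (K j))) :=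
  mulLogVolume_of_norm_eq_zpow K j hϖ (hϖ.norm_eq_zpow_ordFun x)

omit [Fintype J] in
/-- Monotonicity: `‖λ‖ ≤ ‖λ'‖ ⟹ μ^log(λ·O_K) ≤ μ^log(λ'·O_K)`. [cite: MochizukiAbsTopIII2015, Prop. 5.7 (i)(b) p. 137] -/
theorem mulLogVolume_le_of_norm_le (j : J) {x y : (K j)ˣ} (h : ‖(x : K j)‖ ≤ ‖(y : K j)‖) :
    mulLogVolume (K j) x ≤ mulLogVolume (K j) y := by
  obtain ⟨ϖ, hϖ⟩ := exists_isUniformizer (F := K j)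
  have hq : 0 < Real.log (residueCard (K j)) := Real.log_pos (one_lt_residueCard_real (K j))
  have hϖ0 : 0 < ‖(ϖ : K j)‖ := norm_pos_iff.mpr ϖ.ne_zero
  rw [hϖ.norm_eq_zpow_ordFun x, hϖ.norm_eq_zpow_ordFun y,
    zpow_le_zpow_iff_right_of_lt_one₀ hϖ0 hϖ.1] at h
  rw [mulLogVolume_eq_neg_ordFun K j hϖ, mulLogVolume_eq_neg_ordFun K j hϖ, neg_le_neg_iff]
  exact mul_le_mul_of_nonneg_right (by exact_mod_cast h) hq.le

omit [Fintype J] in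
/-- Injectivity on norms: `μ^log(λ·O_K) = μ^log(λ'·O_K) ⟹ ‖λ‖ = ‖λ'‖` ("distinct nested hulls have
distinct log-volumes"). [cite: Mochizuki2012, IUTchIII Rmk. 3.9.5 (iv) p. 129] -/
theorem norm_eq_of_mulLogVolume_eq (j : J) {x y : (K j)ˣ}
    (h : mulLogVolume (K j) x = mulLogVolume (K j) y) : ‖(x : K j)‖ = ‖(y : K j)‖ := by
  obtain ⟨ϖ, hϖ⟩ := exists_isUniformizer (F := K j)
  have hq : 0 < Real.log (residueCard (K j)) := Real.log_pos (one_lt_residueCard_real (K j))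
  rw [mulLogVolume_eq_neg_ordFun K j hϖ, mulLogVolume_eq_neg_ordFun K j hϖ, neg_inj] at h
  have hord : hϖ.ordFun x = hϖ.ordFun y := by exact_mod_cast mul_right_cancel₀ hq.ne' h
  rw [hϖ.norm_eq_zpow_ordFun x, hϖ.norm_eq_zpow_ordFun y, hord]

/-! ### Nested hull sets with the same log-volume coincide -/

/-- **Nested hull sets `H ⊆ H'` with `μ^log(H') ≤ μ^log(H)` are equal** (positive weights): the termwise
monotone sum `Σ_j w_j μ^log(λ_j·O)` can only be `≥` if every term is equal, and equal one-coordinate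
log-volumes force equal radii. [cite: Mochizuki2012, IUTchIII Rmk. 3.9.5 (iv) p. 129] -/
theorem hullSet_eq_of_subset_of_boxLogVolume_le {w : J → ℝ} (hw : ∀ j, 0 < w j) {c d : Π j, (K j)ˣ}
    (hsub : hullSet K (fun j => (c j : K j)) ⊆ hullSet K (fun j => (d j : K j)))
    (hvol : boxLogVolume K w (hullSet K (fun j => (d j : K j))) ≤
      boxLogVolume K w (hullSet K (fun j => (c j : K j)))) :
    hullSet K (fun j => (c j : K j)) = hullSet K (fun j => (d j : K j)) := by
  rw [hullSet_subset_iff] at hsub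
  rw [boxLogVolume_hullSet, boxLogVolume_hullSet] at hvol
  have hle : ∀ j ∈ Finset.univ, w j * mulLogVolume (K j) (c j) ≤ w j * mulLogVolume (K j) (d j) :=
    fun j _ => mul_le_mul_of_nonneg_left (mulLogVolume_le_of_norm_le K j (hsub j)) (hw j).le
  have heq := (Finset.sum_eq_sum_iff_of_le hle).mp (le_antisymm (Finset.sum_le_sum hle) hvol)
  have hnorm : ∀ j, ‖(c j : K j)‖ = ‖(d j : K j)‖ := fun j =>
    norm_eq_of_mulLogVolume_eq K j (mul_left_cancel₀ (hw j).ne' (heq j (Finset.mem_univ j)))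
  unfold hullSet
  congr 1
  funext j
  exact hnorm j

omit [Fintype J] [∀ j, IsUltrametricDist (K j)] [∀ j, ProperSpace (K j)] [∀ j, MeasurableSpace (K j)]
  [∀ j, BorelSpace (K j)] in
/-- A hull set is `λ·O_L` for a family of UNITS `λ`. [cite: Mochizuki2012, IUTchIII Rmk. 3.9.5 (i) p. 127] -/
theorem exists_units_of_isHullSet {H : Set (Π j, K j)} (hH : IsHullSet K H) :
    ∃ c : Π j, (K j)ˣ, H = hullSet K (fun j => (c j : K j)) := by
  obtain ⟨c, hc, rfl⟩ := hH
  exact ⟨fun j => Units.mk0 (c j) (hc j), rfl⟩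

/-- **Discharge of L6's `Remark395iv_hullCase` in the model**: for the hull sets of `⊕_j K_j`, the
constructed hull and the weighted log-volume with positive weights, `Φ(P) = Ξ(P) = {φ(P)}` for every
`P ∈ Hul`. [cite: Mochizuki2012, IUTchIII Rmk. 3.9.5 (iv) p. 129] -/
theorem lt_remark395iv_hullCase {w : J → ℝ} (hw : ∀ j, 0 < w j) :
    LogThetaLattice.Remark395iv_hullCase (hullSets K) (holomorphicHull K) (boxLogVolume K w) := by
  intro P hP
  have hφ : holomorphicHull K P = P := IsHullSet.holomorphicHull_eq K hP
  obtain ⟨d, rfl⟩ := exists_units_of_isHullSet K hP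
  -- every member of `Φ(P)` is `P`
  have hΦ : ∀ H ∈ LogThetaLattice.PhiApprox (hullSets K) (holomorphicHull K) (boxLogVolume K w)
      (hullSet K fun j => (d j : K j)), H = hullSet K fun j => (d j : K j) := by
    rintro H ⟨hH, hsub, hvol⟩
    rw [hφ] at hsub
    obtain ⟨c, rfl⟩ := exists_units_of_isHullSet K hH
    exact hullSet_eq_of_subset_of_boxLogVolume_le K hw hsub hvol
  have hmem : (hullSet K fun j => (d j : K j)) ∈ LogThetaLattice.XiApprox (hullSets K) (holomorphicHull K)
      (boxLogVolume K w) (hullSet K fun j => (d j : K j)) :=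
    ⟨hP, hφ.symm ▸ subset_rfl, rfl⟩
  rw [hφ]
  refine ⟨Set.eq_singleton_iff_unique_mem.mpr ⟨LogThetaLattice.xiApprox_subset_phiApprox _ _ _ _ hmem,
    hΦ⟩, Set.eq_singleton_iff_unique_mem.mpr ⟨hmem, fun H hH => hΦ H
      (LogThetaLattice.xiApprox_subset_phiApprox _ _ _ _ hH)⟩⟩

/-- Consequently (with L6's PROVED `hullMap_mem_phiApprox`-style bookkeeping): for `P ∈ Hul`,
`P = φ(P) = H_Φ(P) = H_Ξ(P)`. [cite: Mochizuki2012, IUTchIII Rmk. 3.9.5 (iv) p. 129] -/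
theorem hPhi_eq_self_of_mem_hullSets {w : J → ℝ} (hw : ∀ j, 0 < w j) {P : Set (Π j, K j)}
    (hP : P ∈ hullSets K) :
    LogThetaLattice.HPhi (hullSets K) (holomorphicHull K) (boxLogVolume K w) P = P ∧
      LogThetaLattice.HXi (hullSets K) (holomorphicHull K) (boxLogVolume K w) P = P := by
  obtain ⟨h1, h2⟩ := lt_remark395iv_hullCase K hw P hP
  have hφ : holomorphicHull K P = P := IsHullSet.holomorphicHull_eq K hP
  unfold LogThetaLattice.HPhi LogThetaLattice.HXi
  rw [h1, h2, hφ, Set.sUnion_singleton]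
  exact ⟨rfl, rfl⟩

end Literature.IUT.LogVolume
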